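import Summits.QuantumFields.YangMills.Theorems.UnitScaleTiltProp8ChartCovariance
import Summits.QuantumFields.YangMills.Theorems.UnitScaleTiltProp8ChartDiff
import Literature.MathematicalPhysics.QuantumFieldTheory.Balaban1983to89.B15DeterminingSets
import Literature.MathematicalPhysics.QuantumFieldTheory.Balaban1983to89.B12SmallFieldDomain259
import HarnessLib

/-!
# Route `UnitScaleTilt`, crux K1 child «MinimiserStabilityRegPr» (stmt-QuantumFields-19200), stub V2′ `stub_halvingStep` — **THE SINGLE-BAR CHART ALONG A BASE-POINT
# GAUGE LINE IS AN EXPLICIT ONE-MATRIX FUNCTION** (the certified backbone of the LOCATED ✗ on (X2-C′-KERNEL), ★★OWNER g26 RULING g26-№4; FINDING w8-1, 19200 evidence #43)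

Cell `ym3-torus` (HUMAN RULING D-0037: YM₃ on the torus is ladder rung R3, not the Clay problem), width seat `ym-ust-19936-w8` gen 0.
`--supports stmt-QuantumFields-19200 --as helper`; def-free, 0 sorry, standard axioms.

WHY.  The chart of record of pillar P3 is `chartLog η D Y (j,c) = −i·log Ū^{(j)}(e^{iηY})(c)` over the SINGLE-BAR (0.4) average `emlIterU` (✓`Prop8ChartDefs`), which is
EXACTLY gauge covariant (✓`Prop8Chart.emlIterU_gaugeActT`: `Ū^{(k)}(V^u) = (Ū^{(k)}V)^{u_k}`, `u_{i+1} = u_i ∘ emb`).  Consequently, for a gauge transformation `g = e^{isM}` at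
ONE fine site `y₀` and a field `Y` vanishing on the `2d` bonds at `y₀`, the straight line `s ↦ Y + s·V` with `V = η⁻¹·M·(𝟙_{b₋ = y₀} − 𝟙_{b₊ = y₀})` IS the gauge orbit, and at
every index bond `c` whose hierarchical centre `embIter j c₋` (resp. `embIter j c₊`) is `y₀` the chart is the explicit one-matrix function
`−i·log(e^{isM}·Ū^{(j)}(c))` (resp. `−i·log(Ū^{(j)}(c)·e^{−isM})`).  At `Y = 0` this is `s·M`: the LINEAR chart responds with the O(1) coarse pure gauge `±M` to a
perturbation of size `η⁻¹` on `2d` bonds (the centre-stair term `dΛ_j` of `Q^{(j)} = Lʲ·bondAvgIter j − dΛ_j`); the second-order term `(i∕2)[M, Φ(c)]` (BCH, same sign for in-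
and out-bonds) is what makes the per-bond kernel of the chart REMAINDER `≍ ηρ` at base-point bonds, not `ρηL^{−2j}` (★w4-19200 g3's exact rationals 06:04Z; this
seat's memo) — the reason (73)∕[B7] (157), facts of print's DOUBLE-BAR chart (89), do not transfer to `chartLog`.
WHAT (def-free; any torus `P`, any complete normed ℂ-algebra `𝔸`).  §1 `val_inv_unit_exp` (`↑(unit e^{X})⁻¹ = e^{−X}`), `tgt_ne_of_src_eq`∕`src_ne_of_tgt_eq`;
★`expCfg_add_gaugeLine` — `expCfg η (Y + s•V) = (expCfg η Y)^{g}` with `g = e^{isM}` at `y₀`, `1` elsewhere.  §2 ★★`chartLog_gaugeLine_src`, ★★`chartLog_gaugeLine_tgt` — the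
two explicit identities; `chartLog_gaugeLine_src_zero` (at `Y = 0`: `= s•M` for `|s|‖M‖ < log 2`).  §3 ★`fderiv_chartLog_zero_gaugeDir_src` — `fderiv ℂ (chartLog η D) 0 V (j,c) = M`
at every index out of the centre over `y₀` (the certified O(1) base-point kernel of the linearisation).
HONEST SCOPE.  Exact identities; the second-order BCH extraction and its consequences for the (X2) chain are in the memo ∕ RULING g26-№4, not here.  NOT a claim about the
stub, the crux, the rung or the mass gap.

References: T. Bałaban, CMP **98** (1985) 17–51 [Balaban1985Averaging] (8)–(11) pp.18–19, (89) p.31, (125) p.36, (147)∕(157) pp.40–42; CMP **109** (1987) 249–301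
[Balaban1987RG1] (0.4)–(0.6) p.253; CMP **102** (1985) 277–309 [Balaban1985Variational] (44)–(47) p.285, (72)–(73) p.289, (152)–(157) pp.301–302.
-/

set_option autoImplicit false

noncomputable section

open scoped BigOperators
open NormedSpace Filter Topology

namespace Summit.QuantumFields.YangMills.Theorems.ChartBasePointGaugeLine

open Literature.MathematicalPhysics.QuantumFieldTheory.Balaban1983to89
open B6SectADomainsV1 (Domains)
open B6SectAOperatorsV1 (BondIdx)
open B15DeterminingSets (embIter)
open B12SmallFieldDomain259 (src_ne_tgt)
open B10Eq27TorusAxialLog (gaugeActT gaugeActT_apply)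
open MatrixLog (mlog)
open B7BlockAvgLog (mlog_exp)
open Summit.QuantumFields.YangMills.Theorems.Prop8Chart
  (isUnit_exp_I_eta expCfg coe_expCfg expCfg_zero emlIterU emlIterU_one chartLog chartLog_apply emlIterU_gaugeActT emlIterU_zero
    differentiableAt_chartLog_zero)

variable {P : Params} {𝔸 : Type*} [NormedRing 𝔸] [NormedAlgebra ℂ 𝔸] [CompleteSpace 𝔸]

/-! ## §1 Units of exponentials; the gauge line is the gauge orbit -/

/-- The inverse of the unit `e^{X}` is `e^{−X}`. [folklore] -/
theorem val_inv_unit_exp (X : 𝔸) (h : IsUnit (exp X)) : ((h.unit⁻¹ : 𝔸ˣ) : 𝔸) = exp (-X) := by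
  letI : NormedAlgebra ℚ 𝔸 := NormedAlgebra.restrictScalars ℚ ℂ 𝔸
  apply Units.inv_eq_of_mul_eq_one_right
  rw [IsUnit.unit_spec, ← exp_add_of_commute (Commute.neg_right (Commute.refl X)), add_neg_cancel, exp_zero]

/-- A bond out of `y₀` does not end at `y₀`. [cite: Balaban1987RG1, (0.1) p.251] -/
theorem tgt_ne_of_src_eq {j : ℕ} {b : PBond P j} {y₀ : Site P j} (h : b.src = y₀) : b.tgt ≠ y₀ := by
  rw [← h]; exact (src_ne_tgt b).symm

/-- A bond into `y₀` does not start at `y₀`. [cite: Balaban1987RG1, (0.1) p.251] -/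
theorem src_ne_of_tgt_eq {j : ℕ} {b : PBond P j} {y₀ : Site P j} (h : b.tgt = y₀) : b.src ≠ y₀ := by
  rw [← h]; exact src_ne_tgt b

/-- ★ **THE GAUGE LINE IS THE GAUGE ORBIT**: if `Y` vanishes on the `2d` bonds at `y₀`, then for every real `s`,
`e^{iη(Y + s·V)} = (e^{iηY})^{g}` bondwise, `V := η⁻¹M·(𝟙_{b₋=y₀} − 𝟙_{b₊=y₀})`, `g(y₀) = e^{isM}`, `g = 1` elsewhere (`η ≠ 0`).
[cite: Balaban1985Averaging, (8) p.19; Balaban1985Variational, (152) p.301] -/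
theorem expCfg_add_gaugeLine {η : ℝ} (hη : η ≠ 0) (y₀ : Site P 0) (M : 𝔸) (s : ℝ) (Y : PBond P 0 → 𝔸)
    (hY : ∀ b : PBond P 0, b.src = y₀ ∨ b.tgt = y₀ → Y b = 0) :
    expCfg η (Y + ((s : ℝ) : ℂ) • fun b : PBond P 0 =>
        (if b.src = y₀ then ((η⁻¹ : ℝ) : ℂ) • M else 0) - (if b.tgt = y₀ then ((η⁻¹ : ℝ) : ℂ) • M else 0)) =
      gaugeActT (fun x : Site P 0 => if embIter 0 x = y₀ then (isUnit_exp_I_eta s M).unit else 1) (expCfg η Y) := by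
  funext b
  apply Units.ext
  rw [coe_expCfg, gaugeActT_apply, Units.val_mul, Units.val_mul, coe_expCfg, Pi.add_apply, Pi.smul_apply]
  simp only [embIter]
  have hηs : (Complex.I * (η : ℂ)) • (((s : ℝ) : ℂ) • (((η⁻¹ : ℝ) : ℂ) • M)) = (Complex.I * (s : ℂ)) • M := by
    rw [smul_smul, smul_smul]
    congr 1
    have hη' : (η : ℂ) ≠ 0 := Complex.ofReal_ne_zero.2 hη
    rw [Complex.ofReal_inv]
    field_simp
  by_cases hs : b.src = y₀
  · have ht : b.tgt ≠ y₀ := tgt_ne_of_src_eq hs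
    rw [if_pos hs, if_neg ht, if_pos hs, if_neg ht, hY b (Or.inl hs), sub_zero, zero_add, IsUnit.unit_spec, inv_one, Units.val_one,
      mul_one, smul_zero, exp_zero, mul_one, hηs]
  · by_cases ht : b.tgt = y₀
    · rw [if_neg hs, if_pos ht, if_neg hs, if_pos ht, hY b (Or.inr ht), zero_sub, zero_add, smul_neg, smul_neg, hηs, Units.val_one, one_mul,
        smul_zero, exp_zero, one_mul, val_inv_unit_exp]
    · rw [if_neg hs, if_neg ht, if_neg hs, if_neg ht, sub_zero, smul_zero, add_zero, Units.val_one, inv_one, Units.val_one, one_mul, mul_one]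

/-! ## §2 The chart along the gauge line -/

omit [NormedAlgebra ℂ 𝔸] [CompleteSpace 𝔸] in
/-- the one-site gauge tower `u_i(x) = g·[embIter i x = y₀]` is compatible with the centres (`embIter (i+1) = embIter i ∘ emb`). [cite: Balaban1987RG1, (0.1) p.251] -/
theorem gaugeTower_succ (y₀ : Site P 0) (g : 𝔸ˣ) (i : ℕ) (y : Site P (i + 1)) :
    (fun (i : ℕ) (x : Site P i) => if embIter i x = y₀ then g else (1 : 𝔸ˣ)) (i + 1) y =
      (fun (i : ℕ) (x : Site P i) => if embIter i x = y₀ then g else (1 : 𝔸ˣ)) i (emb y) := rfl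

/-- ★★ **THE CHART ALONG THE BASE-POINT GAUGE LINE, INDEX OUT OF THE CENTRE**: if `Y` vanishes on the bonds at `y₀` and the index bond `c` of level `j` has
`embIter j c₋ = y₀ ≠ embIter j c₊`, then `chartLog η D (Y + s·V) (j,c) = −i·log(e^{isM}·Ū^{(j)}(e^{iηY})(c))` for every real `s` — exact covariance of the single-bar
average. [cite: Balaban1985Averaging, (11) p.19; Balaban1987RG1, (0.6) p.253; Balaban1985Variational, (156) p.302] -/
theorem chartLog_gaugeLine_src {η : ℝ} (hη : η ≠ 0) (D : Domains P) (y₀ : Site P 0) (M : 𝔸) (s : ℝ) (Y : PBond P 0 → 𝔸)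
    (hY : ∀ b : PBond P 0, b.src = y₀ ∨ b.tgt = y₀ → Y b = 0) (i : BondIdx D)
    (hsrc : embIter (i.1.1 : ℕ) i.1.2.src = y₀) (htgt : embIter (i.1.1 : ℕ) i.1.2.tgt ≠ y₀) :
    chartLog η D (Y + ((s : ℝ) : ℂ) • fun b : PBond P 0 =>
        (if b.src = y₀ then ((η⁻¹ : ℝ) : ℂ) • M else 0) - (if b.tgt = y₀ then ((η⁻¹ : ℝ) : ℂ) • M else 0)) i =
      (-Complex.I) • mlog (exp ((Complex.I * (s : ℂ)) • M) * ((emlIterU (i.1.1 : ℕ) (expCfg η Y) i.1.2 : 𝔸ˣ) : 𝔸)) := by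
  rw [chartLog_apply, expCfg_add_gaugeLine hη y₀ M s Y hY,
    emlIterU_gaugeActT (fun (i : ℕ) (x : Site P i) => if embIter i x = y₀ then (isUnit_exp_I_eta s M).unit else (1 : 𝔸ˣ))
      (gaugeTower_succ y₀ _) (expCfg η Y) (i.1.1 : ℕ), gaugeActT_apply]
  simp only [hsrc, htgt, if_true, if_false, inv_one, mul_one, Units.val_mul, IsUnit.unit_spec]

/-- ★★ **THE SAME, INDEX INTO THE CENTRE**: if `embIter j c₊ = y₀ ≠ embIter j c₋`, then `chartLog η D (Y + s·V) (j,c) = −i·log(Ū^{(j)}(e^{iηY})(c)·e^{−isM})`.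
[cite: Balaban1985Averaging, (11) p.19; Balaban1987RG1, (0.6) p.253; Balaban1985Variational, (156) p.302] -/
theorem chartLog_gaugeLine_tgt {η : ℝ} (hη : η ≠ 0) (D : Domains P) (y₀ : Site P 0) (M : 𝔸) (s : ℝ) (Y : PBond P 0 → 𝔸)
    (hY : ∀ b : PBond P 0, b.src = y₀ ∨ b.tgt = y₀ → Y b = 0) (i : BondIdx D)
    (hsrc : embIter (i.1.1 : ℕ) i.1.2.src ≠ y₀) (htgt : embIter (i.1.1 : ℕ) i.1.2.tgt = y₀) :
    chartLog η D (Y + ((s : ℝ) : ℂ) • fun b : PBond P 0 =>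
        (if b.src = y₀ then ((η⁻¹ : ℝ) : ℂ) • M else 0) - (if b.tgt = y₀ then ((η⁻¹ : ℝ) : ℂ) • M else 0)) i =
      (-Complex.I) • mlog (((emlIterU (i.1.1 : ℕ) (expCfg η Y) i.1.2 : 𝔸ˣ) : 𝔸) * exp (-((Complex.I * (s : ℂ)) • M))) := by
  rw [chartLog_apply, expCfg_add_gaugeLine hη y₀ M s Y hY,
    emlIterU_gaugeActT (fun (i : ℕ) (x : Site P i) => if embIter i x = y₀ then (isUnit_exp_I_eta s M).unit else (1 : 𝔸ˣ))
      (gaugeTower_succ y₀ _) (expCfg η Y) (i.1.1 : ℕ), gaugeActT_apply]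
  simp only [hsrc, htgt, if_true, if_false, one_mul, Units.val_mul, val_inv_unit_exp]

/-- **AT THE FLAT POINT THE CHART ALONG THE GAUGE LINE IS LINEAR**: `chartLog η D (s·V) (j,c) = s·M` for `|s|‖M‖ < log 2` at every index out of the centre over `y₀` —
the response `M = O(1)` to a perturbation of size `η⁻¹·|s|` on `2d` bonds (the centre-stair term of the linearisation). [cite: Balaban1985Averaging, (11) p.19, (147) p.40] -/
theorem chartLog_gaugeLine_src_zero {η : ℝ} (hη : η ≠ 0) (D : Domains P) (y₀ : Site P 0) (M : 𝔸) (s : ℝ) (hs : ‖(Complex.I * (s : ℂ)) • M‖ < Real.log 2)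
    (i : BondIdx D) (hsrc : embIter (i.1.1 : ℕ) i.1.2.src = y₀) (htgt : embIter (i.1.1 : ℕ) i.1.2.tgt ≠ y₀) :
    chartLog η D (((s : ℝ) : ℂ) • fun b : PBond P 0 =>
        (if b.src = y₀ then ((η⁻¹ : ℝ) : ℂ) • M else 0) - (if b.tgt = y₀ then ((η⁻¹ : ℝ) : ℂ) • M else 0)) i = ((s : ℝ) : ℂ) • M := by
  have h := chartLog_gaugeLine_src hη D y₀ M s 0 (fun _ _ => rfl) i hsrc htgt
  rw [zero_add] at h
  rw [h, expCfg_zero, emlIterU_one]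
  simp only [Units.val_one, mul_one]
  rw [mlog_exp hs, smul_smul,
    show -Complex.I * (Complex.I * (s : ℂ)) = (s : ℂ) by rw [← mul_assoc, neg_mul, Complex.I_mul_I, neg_neg, one_mul]]

/-! ## §3 The linearisation in the base-point gauge direction -/

/-- ★ **THE O(1) BASE-POINT KERNEL OF THE LINEAR CHART, CERTIFIED**: `fderiv ℂ (chartLog η D) 0 V (j,c) = M` at every index out of the centre over `y₀`, for the
direction `V = η⁻¹M·(𝟙_{b₋=y₀} − 𝟙_{b₊=y₀})` of size `η⁻¹‖M‖` on `2d` bonds — against the tube weight `≍ η·L^{−2j}·(2d·η⁻¹)‖M‖` a volume-suppressed kernel would give.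
[cite: Balaban1985Averaging, (11) p.19, (125) p.36, (147) p.40] -/
theorem fderiv_chartLog_zero_gaugeDir_src {η : ℝ} (hη : η ≠ 0) (D : Domains P) (y₀ : Site P 0) (M : 𝔸)
    (i : BondIdx D) (hsrc : embIter (i.1.1 : ℕ) i.1.2.src = y₀) (htgt : embIter (i.1.1 : ℕ) i.1.2.tgt ≠ y₀) :
    fderiv ℂ (chartLog η D : (PBond P 0 → 𝔸) → BondIdx D → 𝔸) 0
        (fun b : PBond P 0 => (if b.src = y₀ then ((η⁻¹ : ℝ) : ℂ) • M else 0) - (if b.tgt = y₀ then ((η⁻¹ : ℝ) : ℂ) • M else 0)) i = M := by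
  set V : PBond P 0 → 𝔸 := fun b => (if b.src = y₀ then ((η⁻¹ : ℝ) : ℂ) • M else 0) - (if b.tgt = y₀ then ((η⁻¹ : ℝ) : ℂ) • M else 0) with hV
  -- the component `i` of the chart, as a map, differentiable at `0`
  set F : (PBond P 0 → 𝔸) → 𝔸 := fun A => chartLog η D A i with hF
  have hFd : DifferentiableAt ℂ F 0 := differentiableAt_pi.1 (differentiableAt_chartLog_zero (P := P) (𝔸 := 𝔸) η D) i
  have hFderiv : fderiv ℂ F 0 V = fderiv ℂ (chartLog η D : (PBond P 0 → 𝔸) → BondIdx D → 𝔸) 0 V i := by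
    rw [hF, fderiv_apply (differentiableAt_chartLog_zero (P := P) (𝔸 := 𝔸) η D) i]
    rfl
  -- the real line `s ↦ s·V` through `0`
  have hline : HasDerivAt (fun s : ℝ => ((s : ℝ) : ℂ) • V) V 0 := by
    have h := (Complex.ofRealCLM.hasDerivAt (x := (0 : ℝ))).smul_const V
    simpa using h
  -- chain rule over `ℝ`: the derivative of `F` along the line is `fderiv F 0 V`
  have hcomp : HasDerivAt (fun s : ℝ => F (((s : ℝ) : ℂ) • V)) (fderiv ℂ F 0 V) 0 := by
    have hF' : HasFDerivAt F ((fderiv ℂ F 0).restrictScalars ℝ) (((0 : ℝ) : ℂ) • V) := by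
      rw [Complex.ofReal_zero, zero_smul]; exact hFd.hasFDerivAt.restrictScalars ℝ
    have h := hF'.comp_hasDerivAt (0 : ℝ) hline
    simpa only [Function.comp_def, ContinuousLinearMap.coe_restrictScalars'] using h
  -- but along the line `F` is `s ↦ s·M` near `0`
  have hlin : HasDerivAt (fun s : ℝ => F (((s : ℝ) : ℂ) • V)) M 0 := by
    have hev : ∀ᶠ s : ℝ in 𝓝 0, F (((s : ℝ) : ℂ) • V) = ((s : ℝ) : ℂ) • M := by
      have hopen : ∀ᶠ s : ℝ in 𝓝 0, ‖(Complex.I * (s : ℂ)) • M‖ < Real.log 2 := by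
        have hc : Continuous fun s : ℝ => ‖(Complex.I * (s : ℂ)) • M‖ := by fun_prop
        have h0 : ‖(Complex.I * ((0 : ℝ) : ℂ)) • M‖ < Real.log 2 := by
          rw [Complex.ofReal_zero, mul_zero, zero_smul, norm_zero]; exact Real.log_pos (by norm_num)
        exact hc.continuousAt.eventually_lt continuousAt_const h0
      filter_upwards [hopen] with s hs
      exact chartLog_gaugeLine_src_zero hη D y₀ M s hs i hsrc htgt
    have hsm : HasDerivAt (fun s : ℝ => ((s : ℝ) : ℂ) • M) M 0 := by
      have h := (Complex.ofRealCLM.hasDerivAt (x := (0 : ℝ))).smul_const M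
      simpa using h
    exact hsm.congr_of_eventuallyEq hev
  rw [← hFderiv]
  exact hcomp.unique hlin

end Summit.QuantumFields.YangMills.Theorems.ChartBasePointGaugeLine

end
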